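import Summits.FinalStateConjecture.FinalStateConjecture.Theorems.PhotonSphereChannelsPresentedExteriorDefs
import Summits.FinalStateConjecture.FinalStateConjecture.Theorems.PhotonSphereChannelsChannelsResolveTameDevelopmentsRTrappedSetPresentation
import Summits.FinalStateConjecture.FinalStateConjecture.Theorems.PhotonSphereChannelsChannelsResolveTameDevelopmentsRTrappedSetFlatExterior
import Literature.Geometry.Lorentzian.KerrSchildChartCovariance
import HarnessLib

/-!
# Crux `ChannelsResolveTameDevelopmentsR` (stmt-FinalStateConjecture-14075), line
# `trapped-set-observability-analyticity` — stub `stub_harmonicPresentation` (S3', Reshape 1):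
# the NAMED presentation vocabulary at work, and the corrected S3 REALISED on the Minkowski limit

Reshape 1 made the horizon census (`TameEternalLimit.HasSphericalHorizonSections`) an explicit
hypothesis of S3 (`stub_harmonicPresentation`:
`(∃ κ₀ > 0, E.RedShifted κ₀) → E.HasSphericalHorizonSections → ∃ a r₀ Ξ, E.IsPresentedBy a r₀ Ξ`),
and the line's presented-coordinates vocabulary (`cyl`, `presentationBackground`,
`TameEternalLimit.presentedMetric`, `TameEternalLimit.IsPresentedBy`, `IsPresentedDarkExterior`,
`HasSphericalHorizonSections`) is now LANDED (`PhotonSphereChannelsPresentedExteriorDefs.lean`,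
p110780).  This file (wave 2, worker S3 v2; companions: the unfolded helpers
`…TrappedSetMinkowskiPresented.lean`, p112278, and `…TrappedSetHorizonSections.lean`, p112596,
not imported here — the farm had not built them yet) lands, over the NAMED vocabulary:

* §1 `rfl` bridges (`cyl_coe`, `presentationBackground_eq`) and the ETERNAL COLLAR SLAB in named
  form: for `0 ≤ r₀` the excision collar `{x ∈ cyl a r₀ | r(a,x) < r₀ + δ}` of the `dark` clause
  is nonempty at every coordinate time (audit A3' of `work/stubs/stub_harmonicPresentation_v2.md`;
  for `r₀ < 0` it is empty and the clause vacuous — p107942).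
* §2 no junk in `presentedMetric`: ON the cylinder the presented components are the honest
  pulled-back metric `g(dΞ v, dΞ w)` (the reference form of `presentationBackground` is `0`), OFF
  it the value is `0` and is never read (`iteratedFDeriv` is local on the open cylinder).
* §3 what `IsPresentedBy.{isLocalDiffeomorph, injective, covers}` force (named form of p106294 §4):
  `Ξ` is an open embedding whose range contains `doc ∪ 𝓗`; on a HORIZONLESS limit it is a
  bijection `cyl a r₀ ≅ Z`, and `Z ≅ ℝ⁴` when `r₀ < 0`.
* §4 THE CORRECTED S3 REALISED ON THE ONE LIMIT IN THE TREE.  Every `TameEternalLimit` MODELLED ON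
  MINKOWSKI SPACETIME (`E.Z = Minkowski.spacetime`, whatever its far chart, clock, base point) is
  presented, for every `a` and every `r₀ < 0`, by the identity chart of `cyl a r₀ = E4`, with
  presented components the constant `η` (registered sub-goal `stub_minkowskiModelledLimitPresented`;
  proof: `subst` the model, then the four `G`-independent fields are p106294's
  `stub_minkowskiIdentityPresentation` and `dark` is p107942's `stub_flatIsPresentedDarkExterior`,
  both `rfl`-transported to the named vocabulary).  Applied to the Minkowski tame eternal limit
  with its model exposed (`exists_tameEternalLimit_Z_eq_minkowski`, p112278) this realises the
  corrected S3 — hypotheses (vacuous: empty horizon) AND conclusion — on the dispersive member of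
  its class (assembled in the census companion file once the farm serves p112278).
-/

set_option linter.dupNamespace false

noncomputable section

namespace Summit.FinalStateConjecture.FinalStateConjecture.Theorems.TrappedSet

open Literature.Geometry.Lorentzian
open scoped Manifold ContDiff Topology ENNReal NNReal
open Filter Set Function TopologicalSpace

/-! ## §1 The presentation cylinder: named bridges and the eternal collar slab -/

section Cylinder

/-- The landed unfolded cylinder lemmas (p106294 `stub_cylBasicAPI`, p107942, p112278) speak
about `{x | r₀ < r(a, x)}`: this IS `cyl a r₀`. [folklore] -/
theorem cyl_coe (a r₀ : ℝ) : (cyl a r₀ : Set E4) = {x : E4 | r₀ < Kerr.radius a x} := rfl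

/-- … and about `⟨⟨{x | r₀ < r(a, x)}, _⟩, 0, x⁰, r(a, ·)⟩`: this IS `presentationBackground a r₀`.
[folklore] -/
theorem presentationBackground_eq (a r₀ : ℝ) :
    presentationBackground a r₀ =
      ⟨⟨{x : E4 | r₀ < Kerr.radius a x}, isOpen_lt continuous_const (Kerr.continuous_radius a)⟩, 0,
        fun y ↦ y 0, Kerr.radius a⟩ := rfl

/-- **Every radius level `r ≥ 0` above the excision is met in `cyl a r₀` at every coordinate
time**: `r e₃ + s e₀ ∈ cyl a r₀` has `x⁰ = s` and `r(a, ·) = r`. [folklore] -/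
theorem exists_mem_cyl_radius_eq (a : ℝ) {r₀ r : ℝ} (hr : 0 ≤ r) (h : r₀ < r) (s : ℝ) :
    ∃ x ∈ (cyl a r₀ : Set E4), x 0 = s ∧ Kerr.radius a x = r := by
  have hr' : Kerr.radius a (r • E4.basisVector 3 + s • E4.basisVector 0) = r := by
    rw [Kerr.radius_add_time_smul_basisVector, KerrSchildChart.radius_polar a hr]
  refine ⟨r • E4.basisVector 3 + s • E4.basisVector 0, ?_, by simp, hr'⟩
  rw [mem_cyl, hr']
  exact h

/-- **For `0 ≤ r₀` the excision collar `{x ∈ cyl a r₀ | r(a, x) < r₀ + δ}` of the `dark` clause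
is an honest ETERNAL slab** — nonempty at every coordinate time `x⁰ = s` (witness on the polar
axis at radius `r₀ + δ/2`).  Contrast `r₀ < 0`, where `r ≥ 0 ≥ r₀ + δ` for `δ ≤ -r₀` makes the
collar clause vacuous (`stub_flatIsPresentedDarkExterior`). [folklore] -/
theorem exists_mem_collar (a : ℝ) {r₀ δ : ℝ} (hr₀ : 0 ≤ r₀) (hδ : 0 < δ) (s : ℝ) :
    ∃ x ∈ (cyl a r₀ : Set E4), x 0 = s ∧ Kerr.radius a x < r₀ + δ := by
  obtain ⟨x, hx, hs, hr⟩ :=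
    exists_mem_cyl_radius_eq a (r₀ := r₀) (r := r₀ + δ / 2) (by linarith) (by linarith) s
  exact ⟨x, hx, hs, by rw [hr]; linarith⟩

end Cylinder

/-! ## §2 No junk in the presented components -/

namespace TameEternalLimit

variable (E : TameEternalLimit)

/-- **On the cylinder the presented components ARE the pulled-back metric**
`G(x)(v, w) = g_{Ξ x}(dΞ_x v, dΞ_x w)` (the reference form of `presentationBackground` is `0`).
[cite: Anderson2004, Def. 1.1] -/
theorem presentedMetric_apply_coe (a r₀ : ℝ) (Ξ : cyl a r₀ → E.Z.carrier) (x : cyl a r₀)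
    (v w : E4) :
    E.presentedMetric a r₀ Ξ x v w =
      E.Z.metric.val (Ξ x) (mfderiv 𝓘(ℝ, E4) (𝓡 4) Ξ x v) (mfderiv 𝓘(ℝ, E4) (𝓡 4) Ξ x w) := by
  change E.Z.deviationExtend (presentationBackground a r₀) Ξ x v w = _
  rw [Spacetime.deviationExtend_coe, Spacetime.deviation_apply]
  change _ - (0 : E4 → E4 →L[ℝ] E4 →L[ℝ] ℝ) x.1 v w = _
  rw [Pi.zero_apply, zero_apply, zero_apply, sub_zero]
  rfl

/-- Off the cylinder the presented components are the junk value `0` — never read by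
`IsPresentedDarkExterior`, all of whose clauses quantify `∀ x ∈ cyl a r₀`. [folklore] -/
theorem presentedMetric_of_not_mem (a r₀ : ℝ) (Ξ : cyl a r₀ → E.Z.carrier) {y : E4}
    (hy : y ∉ (cyl a r₀ : Set E4)) : E.presentedMetric a r₀ Ξ y = 0 :=
  E.Z.deviationExtend_of_not_mem (presentationBackground a r₀) Ξ hy

end TameEternalLimit

/-- `iteratedFDeriv` is local: on the OPEN cylinder the `C^k`, symbol and non-radiation clauses of
`IsPresentedDarkExterior` read honest derivatives of whatever `G` is on `cyl a r₀`, independently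
of its extension off the cylinder. [folklore] -/
theorem iteratedFDeriv_eqOn_cyl {F : Type*} [NormedAddCommGroup F] [NormedSpace ℝ F] (a r₀ : ℝ)
    {G G' : E4 → F} (h : EqOn G G' (cyl a r₀ : Set E4)) (k : ℕ) :
    EqOn (iteratedFDeriv ℝ k G) (iteratedFDeriv ℝ k G') (cyl a r₀ : Set E4) := fun x hx ↦ by
  rw [← iteratedFDerivWithin_of_isOpen (𝕜 := ℝ) (f := G) k (cyl a r₀).isOpen hx,
    ← iteratedFDerivWithin_of_isOpen (𝕜 := ℝ) (f := G') k (cyl a r₀).isOpen hx]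
  exact iteratedFDerivWithin_congr (𝕜 := ℝ) h hx k

/-! ## §3 What `isLocalDiffeomorph / injective / covers` force (named form of p106294 §4) -/

namespace TameEternalLimit

namespace IsPresentedBy

variable {E : TameEternalLimit} {a r₀ : ℝ} {Ξ : cyl a r₀ → E.Z.carrier}

/-- A presentation is an open embedding of the cylinder into `Z`. [folklore] -/
theorem isOpenEmbedding (h : E.IsPresentedBy a r₀ Ξ) : Topology.IsOpenEmbedding Ξ :=
  E.isOpenEmbedding_of_isLocalDiffeomorph h.isLocalDiffeomorph h.injective

/-- Its range `W = range Ξ` is open in `Z` (an open submanifold `≅ cyl a r₀`). [folklore] -/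
theorem isOpen_range (h : E.IsPresentedBy a r₀ Ξ) : IsOpen (Set.range Ξ) :=
  h.isLocalDiffeomorph.isOpen_range

/-- It covers the d.o.c. AND every component of the event horizon. [folklore] -/
theorem doc_union_horizon_subset_range (h : E.IsPresentedBy a r₀ Ξ) :
    E.doc ∪ E.horizon ⊆ Set.range Ξ :=
  E.doc_union_horizon_subset_range h.covers

/-- **On a horizonless limit a presentation is bijective** (`covers` + `closure doc = Z`).
[folklore] -/
theorem bijective_of_horizon_eq_empty (h : E.IsPresentedBy a r₀ Ξ) (h𝓗 : E.horizon = ∅) :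
    Function.Bijective Ξ :=
  ⟨h.injective, E.surjective_of_horizon_eq_empty h𝓗 h.covers⟩

/-- Hence `cyl a r₀ ≅ Z` (as `C^∞` manifolds) for a presented horizonless limit. [folklore] -/
theorem nonempty_diffeomorph_of_horizon_eq_empty (h : E.IsPresentedBy a r₀ Ξ)
    (h𝓗 : E.horizon = ∅) :
    Nonempty (Diffeomorph 𝓘(ℝ, E4) (𝓡 4) (cyl a r₀) E.Z.carrier ((⊤ : ℕ∞) : WithTop ℕ∞)) :=
  E.nonempty_diffeomorph_of_horizon_eq_empty h𝓗 h.isLocalDiffeomorph h.injective h.covers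

/-- **The topological content of S3' on horizonless limits presented with `r₀ < 0`: `Z ≅ ℝ⁴`.**
[folklore] -/
theorem nonempty_diffeomorph_E4 (h : E.IsPresentedBy a r₀ Ξ) (h𝓗 : E.horizon = ∅)
    (hr : r₀ < 0) : Nonempty (Diffeomorph (𝓡 4) (𝓡 4) E.Z.carrier E4 ((⊤ : ℕ∞) : WithTop ℕ∞)) :=
  stub_horizonlessPresentedIsR4 E a r₀ hr h𝓗 Ξ h.isLocalDiffeomorph h.injective h.covers

end IsPresentedBy

end TameEternalLimit

/-! ## §4 The corrected S3 realised: Minkowski-modelled limits are presented -/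

section Minkowski

/-- The presented components of Minkowski spacetime in the identity chart of `cyl a r₀`,
`r₀ < 0`, are the constant `η` on all of `E4` (named form of p106294's
`deviationExtend_cyl_subtypeVal_minkowski`). [folklore] -/
theorem deviationExtend_presentationBackground_subtypeVal_minkowski (a : ℝ) {r₀ : ℝ}
    (h : r₀ < 0) :
    Minkowski.spacetime.deviationExtend (presentationBackground a r₀) Subtype.val =
      fun _ ↦ Minkowski.bilin :=
  deviationExtend_cyl_subtypeVal_minkowski a h

/-- **Flat space is a presented dark exterior for `r₀ < 0`**, in the named vocabulary (the body
of `IsPresentedDarkExterior a r₀ (fun _ ↦ η)` is p107942's `stub_flatIsPresentedDarkExterior`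
verbatim). [folklore] -/
theorem isPresentedDarkExterior_const_minkowski (a : ℝ) {r₀ : ℝ} (h : r₀ < 0) :
    IsPresentedDarkExterior a r₀ (fun _ ↦ Minkowski.bilin) :=
  stub_flatIsPresentedDarkExterior a r₀ h

/-- **Every tame eternal limit modelled on Minkowski spacetime is presented, for every `a` and
every `r₀ < 0`, by the identity chart of `cyl a r₀ = E4`** — a surjective presentation with
presented components the constant `η`.  The far chart, clock, base point and generator field of
`E` are irrelevant: `isLocalDiffeomorph`, `injective`, `covers` (`range = univ`), `future`
(`ι_*(−♯_η dx⁰) = ∂₀`) and `dark` (flat space, empty collar) only see `Z = (ℝ⁴, η, ∂₀)`.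
[folklore] -/
theorem TameEternalLimit.exists_isPresentedBy_of_Z_eq_minkowski (E : TameEternalLimit)
    (hZ : E.Z = Minkowski.spacetime) (a : ℝ) {r₀ : ℝ} (h : r₀ < 0) :
    ∃ Ξ : cyl a r₀ → E.Z.carrier, Function.Surjective Ξ ∧ E.IsPresentedBy a r₀ Ξ ∧
      E.presentedMetric a r₀ Ξ = fun _ ↦ Minkowski.bilin := by
  obtain ⟨Z, z, M, R, Φ, t, L, h1, h2, h3, h4, h5, h6, h7, h8, h9, h10, h11, h12, h13, h14, h15, h16,
    h17, h18, h19, h20⟩ := E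
  dsimp only at hZ
  subst hZ
  refine ⟨Subtype.val, fun y ↦ ⟨⟨y, h.trans_le (Kerr.radius_nonneg a y)⟩, rfl⟩,
    ⟨isLocalDiffeomorph_subtypeVal_minkowski _, Subtype.val_injective,
      subset_range_cyl_subtypeVal a h _, isFutureDirected_identityPresentation a h, ?_⟩,
    deviationExtend_cyl_subtypeVal_minkowski a h⟩
  change IsPresentedDarkExterior a r₀
    (Minkowski.spacetime.deviationExtend (presentationBackground a r₀) Subtype.val)
  rw [deviationExtend_presentationBackground_subtypeVal_minkowski a h]
  exact isPresentedDarkExterior_const_minkowski a h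

/-- Registered sub-goal `stub_minkowskiModelledLimitPresented` of `stub_harmonicPresentation`
(S3', Reshape 1): the statement of `TameEternalLimit.exists_isPresentedBy_of_Z_eq_minkowski` as
a closed `Prop` — every Minkowski-modelled tame eternal limit is (surjectively) presented on
`cyl a r₀`, `r₀ < 0`, with components `≡ η`. [folklore] -/
theorem stub_minkowskiModelledLimitPresented :
    ∀ (E : TameEternalLimit), E.Z = Minkowski.spacetime → ∀ (a r₀ : ℝ), r₀ < 0 → ∃ Ξ : cyl a r₀ → E.Z.carrier, Function.Surjective Ξ ∧ E.IsPresentedBy a r₀ Ξ ∧ E.presentedMetric a r₀ Ξ = fun _ ↦ Minkowski.bilin :=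
  fun E hZ a _ h ↦ E.exists_isPresentedBy_of_Z_eq_minkowski hZ a h

end Minkowski

end Summit.FinalStateConjecture.FinalStateConjecture.Theorems.TrappedSet

end
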